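import Summits.ValiantsHypothesis.ValiantsHypothesis.Theorems.DepthWindowGrowing
import HarnessLib

/-!
# Route `DepthWindow` — the below-one-half rung: `per` is hard at product-depth `⌊p ⌊log₂log₂log₂ n⌋ / q⌋`, `2p < q`

Helper file of the route `Theses/DepthWindow.lean` (decomp-valiant workshop, lens 4, generation 4).  The crux
`PerHardLog3` asks that `per` have no polynomial-wire circuits over `ℂ` of product-depth `⌊log₂⌊log₂⌊log₂ n⌋⌋⌋ + 1`
(slope `κ = 1`); generation 2 proved the constant-depth rung `perHardConstDepth` (`κ = 0`), generation 3 the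
growing rung `perHardGrowingDepth` (`κ = 1/3`).  Here the whole half-open interval: `perHardBelowHalf p q (2p < q)`
— no `c` such that every `per_n` has a circuit of product-depth `≤ ⌊p · ⌊log₂⌊log₂⌊log₂ n⌋⌋⌋ / q⌋` with `≤ n ^ c + c`
wires — and its registered-stub (`∀ c ∃ n`) form `perHardBelowHalf_lst` (WEAKER than the crux by
`DepthWindowDial.perHardAtDepth_anti`; `perHardGrowingDepth` is literally the instance `p = 1, q = 3`).
Mechanism: the explicit-constant LST bound `lst_explicit` (`DepthWindowLSTExplicit.lean`; `μ_Δ ≥ 2^{-(2Δ+1)}`) for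
the `VP` family `m ↦ IMM_{m, d(m)}`, `d(m) = min m ⌊μ_{Δ⁺(m)}/(30000 Δ⁺(m)) · log m⌋`,
`Δ⁺(m) = ⌊p (⌊log₂log₂log₂ m⌋ + 1) / q⌋ + 1`, transported to the `VNP`-complete permanent along a p-projection
(`isVNPComplete_perPoly_holds`, `exists_circuit_of_isProjection`), evaluated at ONE tower `m = 2^(2^(2^(qZ)))`,
`Z = q + a + 2b + 64`, `Δ = pZ + 1`, where all side conditions are crude dyadic arithmetic (`half_tower_arith`,
`tower_facts_gen` = generation 3's `tower_facts` with the height `Y` decoupled from the depth `Δ`): transported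
depth `≤ ⌊p (qZ + 1)/q⌋ = pZ ≤ Δ`, `ε log m ≥ W := B^{2^{2Δ+2}}` (`B = 409600 Δ² + 1440 (Δ+1) + b + 1`),
`d(m)^{μ/2} ≥ B ≥ b + 1`, `m^{b+1} ≤ size ≤ m^b + b`.  The tower inequality needs `2Δ + O(log Δ + log b) ≤ qZ`,
i.e. `2p < q`: the slope `1/2` is the exact reach of `lst_explicit`'s side condition
`30000 Δ · 2^{2Δ+1} · d ≤ μ_Δ⁻¹ … ≤ log m` (kernel ceiling `lst_explicit_ceiling` in `DepthWindowHalfDial.lean`).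
Rung currency only: tree line of the dial now `[0, 1/2)`; print line `κ < 0.72` [BhargavDuttaSaxena2024, Thm 1.1 /
Rem. 1.6]; crux at `κ = 1 (+1)`.  Unconditional, 0 sorry, def-free; nothing here bears on `VP ≠ VNP` itself.
References: [LimayeSrinivasanTavenas2025] Cor. 4, Claim 16; [Valiant1979]; [Burgisser2000TCS] §2; [BhargavDuttaSaxena2024].
-/

-- layout Summits/ValiantsHypothesis/ValiantsHypothesis forces the duplicated namespace component
set_option linter.dupNamespace false

namespace Summit.ValiantsHypothesis.ValiantsHypothesis.Theorems.DepthWindow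

open MvPolynomial Real Literature.Computability.AlgebraicComplexity ArithCircuit
open Literature.Computability.AlgebraicComplexity.LSTWord
open Literature.Computability.Complexity

noncomputable section

/-! ### Dyadic bookkeeping below one half -/

/-- `(n + 32)² ≤ 2^(n + 11)`. [folklore] -/
theorem sq_add_le_two_pow (n : ℕ) : (n + 32) ^ 2 ≤ 2 ^ (n + 11) := by
  induction n with
  | zero => norm_num
  | succ n ih =>
    have h1 : n < 2 ^ n := Nat.lt_two_pow_self
    have h2 : 2 ^ (n + 1 + 11) = 2 * 2 ^ (n + 11) := by
      rw [show n + 1 + 11 = (n + 11) + 1 by omega, pow_succ]; ring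
    have h3 : 2 ^ (n + 11) = 2 ^ n * 2 ^ 11 := pow_add _ _ _
    rw [h2]
    nlinarith

/-- `3 Δ + 17 ≤ 2^(Δ + 5)`. [folklore] -/
theorem three_mul_add_le_two_pow (Δ : ℕ) : 3 * Δ + 17 ≤ 2 ^ (Δ + 5) := by
  have h1 : Δ < 2 ^ Δ := Nat.lt_two_pow_self
  have h2 : 2 ^ (Δ + 5) = 2 ^ Δ * 32 := by rw [pow_add]; norm_num
  omega

/-- **The side arithmetic below one half.**  For `2p + 1 ≤ q`, `q + 2b + 64 ≤ Z`, `Δ = pZ + 1`: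
`60000 Δ · 2^{2Δ+1} · B^{2·2^{2Δ+1}} ≤ 2^(2^(qZ))` with `B = 409600 Δ² + 1440 (Δ+1) + b + 1`. [folklore] -/
theorem half_tower_arith (p q Z b Δ : ℕ) (hpq : 2 * p + 1 ≤ q) (hZ : q + 2 * b + 64 ≤ Z)
    (hΔ : Δ = p * Z + 1) :
    60000 * Δ * 2 ^ (2 * Δ + 1) *
        (409600 * Δ ^ 2 + 1440 * (Δ + 1) + b + 1) ^ (2 * 2 ^ (2 * Δ + 1))
      ≤ 2 ^ (2 ^ (q * Z)) := by
  obtain ⟨V, rfl⟩ : ∃ V, Z = V + 64 := ⟨Z - 64, by omega⟩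
  -- `B ≤ 2^(2(Δ+b+15))`
  have hB : 409600 * Δ ^ 2 + 1440 * (Δ + 1) + b + 1 ≤ 2 ^ (2 * (Δ + b + 15)) := by
    have h := towerB_le (Δ + b + 15) b (by omega)
    have h1 : Δ ^ 2 ≤ (Δ + b + 15 + 1) ^ 2 := Nat.pow_le_pow_left (by omega) 2
    have h2 : 409600 * Δ ^ 2 ≤ 409600 * (Δ + b + 15 + 1) ^ 2 := Nat.mul_le_mul_left _ h1
    linarith
  -- first factor `≤ 2^(3Δ+17)`
  have hF : 60000 * Δ * 2 ^ (2 * Δ + 1) ≤ 2 ^ (3 * Δ + 17) := by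
    have hΔ2 : Δ < 2 ^ Δ := Nat.lt_two_pow_self
    calc 60000 * Δ * 2 ^ (2 * Δ + 1) ≤ 2 ^ 16 * 2 ^ Δ * 2 ^ (2 * Δ + 1) :=
          Nat.mul_le_mul_right _ (Nat.mul_le_mul (by norm_num) hΔ2.le)
      _ = 2 ^ (3 * Δ + 17) := by rw [← pow_add, ← pow_add]; congr 1; ring
  -- second factor `≤ 2^((Δ+b+15) · 2^(2Δ+3))`
  have hS : (409600 * Δ ^ 2 + 1440 * (Δ + 1) + b + 1) ^ (2 * 2 ^ (2 * Δ + 1))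
      ≤ 2 ^ ((Δ + b + 15) * 2 ^ (2 * Δ + 3)) := by
    have hexp : 2 * 2 ^ (2 * Δ + 1) = 2 ^ (2 * Δ + 2) := by
      rw [show 2 * Δ + 2 = (2 * Δ + 1) + 1 by ring, pow_succ]; ring
    rw [hexp]
    calc _ ≤ (2 ^ (2 * (Δ + b + 15))) ^ (2 ^ (2 * Δ + 2)) := Nat.pow_le_pow_left hB _
      _ = 2 ^ ((Δ + b + 15) * 2 ^ (2 * Δ + 3)) := by
          rw [← pow_mul]; congr 1
          rw [show 2 * Δ + 3 = (2 * Δ + 2) + 1 by ring, pow_succ]; ring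
  -- exponent bookkeeping: `M := 2Δ + 3 + V + 43`, `M + 1 ≤ q (V + 64)`
  have hp : p ≤ V := by omega
  have hqZ : 2 * Δ + 3 + V + 43 + 1 ≤ q * (V + 64) := by
    have h1 : (2 * p + 1) * (V + 64) ≤ q * (V + 64) := Nat.mul_le_mul_right _ hpq
    have h2 : (2 * p + 1) * (V + 64) = 2 * (p * (V + 64)) + V + 64 := by ring
    rw [hΔ]; omega
  have hcoef : Δ + b + 15 ≤ 2 ^ (V + 43) := by
    have h1 : (V + 32 + 32) ^ 2 ≤ 2 ^ (V + 32 + 11) := sq_add_le_two_pow (V + 32)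
    have h2 : p * (V + 64) ≤ V * (V + 64) := Nat.mul_le_mul_right _ hp
    have h3 : Δ + b + 15 ≤ (V + 64) ^ 2 := by rw [hΔ]; nlinarith
    calc Δ + b + 15 ≤ (V + 64) ^ 2 := h3
      _ = (V + 32 + 32) ^ 2 := by ring
      _ ≤ 2 ^ (V + 32 + 11) := h1
      _ = 2 ^ (V + 43) := by ring_nf
  have hE2 : (Δ + b + 15) * 2 ^ (2 * Δ + 3) ≤ 2 ^ (2 * Δ + 3 + V + 43) := by
    calc (Δ + b + 15) * 2 ^ (2 * Δ + 3) ≤ 2 ^ (V + 43) * 2 ^ (2 * Δ + 3) :=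
          Nat.mul_le_mul_right _ hcoef
      _ = 2 ^ (2 * Δ + 3 + V + 43) := by rw [← pow_add]; congr 1; ring
  have hE1 : 3 * Δ + 17 ≤ 2 ^ (2 * Δ + 3 + V + 43) :=
    (three_mul_add_le_two_pow Δ).trans (Nat.pow_le_pow_right two_pos (by omega))
  have hE : 3 * Δ + 17 + (Δ + b + 15) * 2 ^ (2 * Δ + 3) ≤ 2 ^ (q * (V + 64)) := by
    have h1 : 2 ^ (2 * Δ + 3 + V + 43 + 1) ≤ 2 ^ (q * (V + 64)) := Nat.pow_le_pow_right two_pos hqZ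
    have h2 : 2 ^ (2 * Δ + 3 + V + 43 + 1) = 2 * 2 ^ (2 * Δ + 3 + V + 43) := by rw [pow_succ]; ring
    omega
  calc 60000 * Δ * 2 ^ (2 * Δ + 1) *
        (409600 * Δ ^ 2 + 1440 * (Δ + 1) + b + 1) ^ (2 * 2 ^ (2 * Δ + 1))
      ≤ 2 ^ (3 * Δ + 17) * 2 ^ ((Δ + b + 15) * 2 ^ (2 * Δ + 3)) := Nat.mul_le_mul hF hS
    _ = 2 ^ (3 * Δ + 17 + (Δ + b + 15) * 2 ^ (2 * Δ + 3)) := (pow_add _ _ _).symm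
    _ ≤ 2 ^ (2 ^ (q * (V + 64))) := Nat.pow_le_pow_right two_pos hE


/-! ### The side conditions at a general tower -/

/-- **All side conditions at the tower `m = 2^(2^(2^Y))`, packaged** (the generation-3 `tower_facts` with the
depth `Δ` decoupled from the height `Y`: the only link is the hypothesis `htower`).  With
`W = B^{2 · 2^{2Δ+1}}` (`B = 409600 Δ² + 1440 (Δ+1) + b + 1`): `2 ≤ m`, `1 ≤ W ≤ m`, `⌊log₂log₂log₂ m⌋ = Y`, a
polynomially larger index has `⌊log₂log₂log₂⌋ ≤ Y + 1`, `W ≤ μ_Δ/(30000Δ) · log m`, every `d ≥ W` clears the LST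
threshold with `d^{μ_Δ/2} ≥ b + 1`, and no `s ≤ m^b + b` is `≥ m^{b+1}`. [folklore] -/
theorem tower_facts_gen (Y b Δ : ℕ) (hΔ1 : 1 ≤ Δ)
    (htower : 60000 * Δ * 2 ^ (2 * Δ + 1) *
        (409600 * Δ ^ 2 + 1440 * (Δ + 1) + b + 1) ^ (2 * 2 ^ (2 * Δ + 1)) ≤ 2 ^ (2 ^ Y)) :
    ∃ m W : ℕ, 2 ≤ m ∧ 1 ≤ W ∧ W ≤ m ∧
      Nat.log 2 (Nat.log 2 (Nat.log 2 m)) = Y ∧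
      (∀ a t : ℕ, a + 1 ≤ 2 ^ Y → t ≤ m ^ a + a →
        Nat.log 2 (Nat.log 2 (Nat.log 2 t)) ≤ Y + 1) ∧
      (W : ℝ) ≤ mu Δ / (30000 * (Δ : ℝ)) * Real.log m ∧
      (∀ d : ℕ, W ≤ d →
        409600 * (Δ : ℝ) ^ 2 + 1440 * ((Δ : ℝ) + 1) ≤ (d : ℝ) ^ mu Δ ∧
          (b : ℝ) + 1 ≤ (d : ℝ) ^ (mu Δ / 2)) ∧
      (∀ s : ℕ, s ≤ m ^ b + b → ¬ (m : ℝ) ^ ((b : ℝ) + 1) ≤ s) := by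
  obtain ⟨E, hE⟩ : ∃ E : ℕ, E = 2 ^ (2 ^ Y) := ⟨_, rfl⟩
  obtain ⟨m, hm⟩ : ∃ m : ℕ, m = 2 ^ E := ⟨_, rfl⟩
  obtain ⟨q, hq⟩ : ∃ q : ℕ, q = 2 ^ (2 * Δ + 1) := ⟨_, rfl⟩
  obtain ⟨B, hB⟩ : ∃ B : ℕ, B = 409600 * Δ ^ 2 + 1440 * (Δ + 1) + b + 1 := ⟨_, rfl⟩
  obtain ⟨W, hW⟩ : ∃ W : ℕ, W = B ^ (2 * q) := ⟨_, rfl⟩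
  have hE1 : 1 ≤ E := hE ▸ Nat.one_le_two_pow
  have hm2 : 2 ≤ m := by
    rw [hm]
    calc (2 : ℕ) = 2 ^ 1 := (pow_one 2).symm
      _ ≤ 2 ^ E := Nat.pow_le_pow_right two_pos hE1
  have hmR1 : (1 : ℝ) ≤ m := by exact_mod_cast (show 1 ≤ m by omega)
  have hmpos : (0 : ℝ) < m := by linarith
  have hq1 : 1 ≤ q := hq ▸ Nat.one_le_two_pow
  have hB1 : 1 ≤ B := by rw [hB]; omega
  have hBpos : 0 < B := hB1
  have hW1 : 1 ≤ W := by rw [hW]; exact Nat.one_le_pow _ _ hBpos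
  have hΔ1R : (1 : ℝ) ≤ Δ := by exact_mod_cast hΔ1
  have hΔpos : (0 : ℝ) < Δ := by linarith
  have hqR : (q : ℝ) = (2 : ℝ) ^ (2 * Δ + 1) := by rw [hq]; push_cast; ring
  have hqpos : (0 : ℝ) < q := by exact_mod_cast hq1
  have hB0 : (0 : ℝ) ≤ B := Nat.cast_nonneg B
  have hBR : (B : ℝ) = 409600 * (Δ : ℝ) ^ 2 + 1440 * ((Δ : ℝ) + 1) + b + 1 := by
    rw [hB]; push_cast; ring
  -- `μ_Δ ≥ 1/q`
  have hμq : 1 / (q : ℝ) ≤ mu Δ := by rw [hqR]; exact inv_two_pow_le_mu Δ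
  have hμ1 : mu Δ ≤ 1 := mu_le_one _
  -- the dyadic bookkeeping, cast to `ℝ`
  have htower' : 60000 * Δ * q * W ≤ E := by
    rw [hW, hB, hq, hE]; exact htower
  have htR : (60000 : ℝ) * Δ * q * W ≤ E := by
    have h := (Nat.cast_le (α := ℝ)).2 htower'
    push_cast at h
    exact h
  -- `log m ≥ E/2`
  have hlogm : (E : ℝ) / 2 ≤ Real.log m := by
    have hmR : (m : ℝ) = (2 : ℝ) ^ E := by rw [hm]; push_cast; ring
    rw [hmR, Real.log_pow]
    have h2 : (1 : ℝ) / 2 ≤ Real.log 2 := by have := Real.log_two_gt_d9; linarith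
    have hE0 : (0 : ℝ) ≤ E := Nat.cast_nonneg E
    calc (E : ℝ) / 2 = E * (1 / 2) := by ring
      _ ≤ E * Real.log 2 := mul_le_mul_of_nonneg_left h2 hE0
  -- `W ≤ ε log m`
  have hWε : (W : ℝ) ≤ mu Δ / (30000 * (Δ : ℝ)) * Real.log m := by
    have hεlow : 1 / (30000 * (Δ : ℝ) * q) ≤ mu Δ / (30000 * (Δ : ℝ)) := by
      have h1 : 1 / (30000 * (Δ : ℝ) * q) = (1 / (q : ℝ)) / (30000 * (Δ : ℝ)) := by
        field_simp
      rw [h1]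
      exact div_le_div_of_nonneg_right hμq (by positivity)
    have h1 : (W : ℝ) ≤ 1 / (30000 * (Δ : ℝ) * q) * ((E : ℝ) / 2) := by
      rw [show 1 / (30000 * (Δ : ℝ) * q) * ((E : ℝ) / 2) = (E : ℝ) / (60000 * (Δ : ℝ) * q) by
        field_simp; ring]
      rw [le_div_iff₀ (by positivity)]
      linarith
    have hε0 : 0 ≤ mu Δ / (30000 * (Δ : ℝ)) := div_nonneg (mu_pos Δ).le (by positivity)
    exact h1.trans (mul_le_mul hεlow hlogm (by positivity) hε0)
  -- `W ≤ m`
  have hWm : W ≤ m := by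
    have h1 : mu Δ / (30000 * (Δ : ℝ)) * Real.log m ≤ 1 * Real.log m := by
      refine mul_le_mul_of_nonneg_right ?_ (Real.log_nonneg hmR1)
      rw [div_le_one (by positivity)]; linarith
    have h2 : Real.log m ≤ (m : ℝ) := (Real.log_le_sub_one_of_pos hmpos).trans (by linarith)
    exact_mod_cast (hWε.trans (h1.trans ((one_mul _).trans_le h2)))
  refine ⟨m, W, hm2, hW1, hWm, ?_, ?_, hWε, ?_, ?_⟩
  · rw [hm, hE]; exact log3_tower _
  · intro a t ha ht
    refine log3_le_of_le_tower_pow Y a t ha ?_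
    rw [← hE, ← hm]; exact ht
  · intro d hWd
    have hd1 : (1 : ℝ) ≤ d := by exact_mod_cast hW1.trans hWd
    have hWdR : (W : ℝ) ≤ d := by exact_mod_cast hWd
    constructor
    · have h1 : (W : ℝ) ^ (1 / (q : ℝ)) = (B : ℝ) ^ 2 := by
        rw [hW, one_div, Nat.cast_pow, pow_mul]
        exact Real.pow_rpow_inv_natCast (by positivity) (by omega)
      have h2 : (W : ℝ) ^ (1 / (q : ℝ)) ≤ (d : ℝ) ^ (1 / (q : ℝ)) :=
        Real.rpow_le_rpow (Nat.cast_nonneg W) hWdR (by positivity)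
      have h3 : (d : ℝ) ^ (1 / (q : ℝ)) ≤ (d : ℝ) ^ mu Δ :=
        Real.rpow_le_rpow_of_exponent_le hd1 hμq
      have hB1R : (1 : ℝ) ≤ B := by exact_mod_cast hB1
      have h4 : (B : ℝ) ≤ (B : ℝ) ^ 2 := by nlinarith
      have hb0 : (0 : ℝ) ≤ b := Nat.cast_nonneg b
      calc 409600 * (Δ : ℝ) ^ 2 + 1440 * ((Δ : ℝ) + 1) ≤ (B : ℝ) := by rw [hBR]; linarith
        _ ≤ (B : ℝ) ^ 2 := h4
        _ = (W : ℝ) ^ (1 / (q : ℝ)) := h1.symm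
        _ ≤ (d : ℝ) ^ mu Δ := h2.trans h3
    · have h1 : (W : ℝ) ^ (1 / ((2 * q : ℕ) : ℝ)) = (B : ℝ) := by
        rw [hW, one_div, Nat.cast_pow]
        exact Real.pow_rpow_inv_natCast hB0 (by omega)
      have h2 : (W : ℝ) ^ (1 / ((2 * q : ℕ) : ℝ)) ≤ (d : ℝ) ^ (1 / ((2 * q : ℕ) : ℝ)) :=
        Real.rpow_le_rpow (Nat.cast_nonneg W) hWdR (by positivity)
      have h3 : (d : ℝ) ^ (1 / ((2 * q : ℕ) : ℝ)) ≤ (d : ℝ) ^ (mu Δ / 2) := by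
        refine Real.rpow_le_rpow_of_exponent_le hd1 ?_
        have : 1 / ((2 * q : ℕ) : ℝ) = (1 / (q : ℝ)) / 2 := by
          push_cast; field_simp
        rw [this]; linarith
      have hpos : (0 : ℝ) ≤ 409600 * (Δ : ℝ) ^ 2 + 1440 * ((Δ : ℝ) + 1) := by positivity
      calc (b : ℝ) + 1 ≤ B := by rw [hBR]; linarith
        _ = (W : ℝ) ^ (1 / ((2 * q : ℕ) : ℝ)) := h1.symm
        _ ≤ (d : ℝ) ^ (mu Δ / 2) := h2.trans h3
  · intro s hs hle
    have hnat : m ^ b + b < m ^ (b + 1) := pow_add_lt_pow_succ hm2 b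
    have hup : (s : ℝ) ≤ ((m ^ b + b : ℕ) : ℝ) := by exact_mod_cast hs
    have hlt : ((m ^ b + b : ℕ) : ℝ) < (m : ℝ) ^ ((b : ℝ) + 1) := by
      calc ((m ^ b + b : ℕ) : ℝ) < ((m ^ (b + 1) : ℕ) : ℝ) := by exact_mod_cast hnat
        _ = (m : ℝ) ^ ((b : ℝ) + 1) := by
            rw [show ((b : ℝ) + 1) = ((b + 1 : ℕ) : ℝ) by push_cast; ring, Real.rpow_natCast]
            push_cast; ring
    exact absurd (hle.trans hup) (not_le.2 hlt)


/-! ### The rung: every slope below one half -/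

/-- **The below-one-half rung, PROVED** (every `κ = p/q < 1/2`): for `2p < q` the permanent has no
polynomial-wire circuits over `ℂ` of product-depth `≤ ⌊p · ⌊log₂⌊log₂⌊log₂ n⌋⌋⌋ / q⌋` — the statement of the
crux `PerHardLog3` (slope `1`, offset `+1`) at every slope strictly below `1/2`, and the generation-3 rung
`perHardGrowingDepth` is its instance `p = 1, q = 3`.  Limaye–Srinivasan–Tavenas with explicit constants
(`lst_explicit`) for the `VP` family `m ↦ IMM_{m, d(m)}` transported to the `VNP`-complete permanent along a
p-projection (`isVNPComplete_perPoly_holds`, `exists_circuit_of_isProjection`), evaluated at one tower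
`m = 2^(2^(2^(qZ)))` (`tower_facts_gen`, `half_tower_arith`).  The slope `1/2` is exactly where the side
condition `30000 Δ · 2^{2Δ+1} · d ≤ log m` of `lst_explicit` (i.e. `2Δ + O(1) ≤ log₂log₂log₂ m`) stops being
satisfiable: see `lst_explicit_ceiling`.
[cite: LimayeSrinivasanTavenas2025, Cor. 4] [cite: Valiant1979] -/
theorem perHardBelowHalf (p q : ℕ) (hpq : 2 * p < q) :
    ¬ ∃ c : ℕ, ∀ n : ℕ, ∃ C : ArithCircuit ℂ (Fin n × Fin n),
      C.Computes (perPoly (Fin n) ℂ) ∧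
        C.productDepth ≤ p * Nat.log 2 (Nat.log 2 (Nat.log 2 n)) / q ∧ C.edgeSize ≤ n ^ c + c := by
  classical
  rintro ⟨c, hc⟩
  have hq0 : 0 < q := by omega
  have hpq' : p < q := by omega
  -- the depth at which LST is applied, its `ε`, and the degree function
  let Dp : ℕ → ℕ := fun m => p * (Nat.log 2 (Nat.log 2 (Nat.log 2 m)) + 1) / q + 1
  let ee : ℕ → ℝ := fun m => mu (Dp m) / (30000 * (Dp m : ℝ))
  let dd : ℕ → ℕ := fun m => min m ⌊ee m * Real.log m⌋₊
  have hdd_le : ∀ m, dd m ≤ m := fun m => min_le_left _ _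
  have hee0 : ∀ m, 0 ≤ ee m := fun m => div_nonneg (mu_pos _).le (by positivity)
  have hdd_log : ∀ m, (dd m : ℝ) ≤ ee m * Real.log m := fun m => by
    have h0 : 0 ≤ ee m * Real.log m := mul_nonneg (hee0 m) (Real.log_natCast_nonneg m)
    exact (Nat.cast_le.2 (min_le_right _ _)).trans (Nat.floor_le h0)
  -- the IMM family and its renaming to `Fin (v m)` variables
  let v : ℕ → ℕ := fun m => Fintype.card (Fin (dd m) × Fin m × Fin m)
  let e : ∀ m, (Fin (dd m) × Fin m × Fin m) ≃ Fin (v m) := fun m => Fintype.equivFin _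
  let G : ∀ m, MvPolynomial (Fin (dd m) × Fin m × Fin m) ℂ := fun m => immPoly m (dd m) ℂ
  let G' : ∀ m, MvPolynomial (Fin (v m)) ℂ := fun m => renameEquiv ℂ (e m) (G m)
  have hG : IsVPFamily G := by
    refine ⟨⟨⟨3, fun m => ?_⟩, ⟨1, fun m => ?_⟩⟩, ⟨6, fun m => ?_⟩⟩
    · show Fintype.card (Fin (dd m) × Fin m × Fin m) ≤ m ^ 3 + 3
      simp only [Fintype.card_prod, Fintype.card_fin]
      calc dd m * (m * m) ≤ m * (m * m) := Nat.mul_le_mul_right _ (hdd_le m)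
        _ = m ^ 3 := by ring
        _ ≤ m ^ 3 + 3 := Nat.le_add_right _ _
    · show (immPoly m (dd m) ℂ).totalDegree ≤ m ^ 1 + 1
      refine ((immPoly_isHomogeneous_holds (k := ℂ) m (dd m)).totalDegree_le).trans ?_
      rw [pow_one]; exact (hdd_le m).trans (Nat.le_succ m)
    · show complexity (immPoly m (dd m) ℂ) ≤ m ^ 6 + 6
      calc complexity (immPoly m (dd m) ℂ) ≤ m + 2 * m ^ 3 * dd m := complexity_immPoly_le ℂ m (dd m)
        _ ≤ m ^ 1 + 2 * (m ^ 1) ^ 3 * m := by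
            rw [pow_one]; exact Nat.add_le_add_left (Nat.mul_le_mul_left _ (hdd_le m)) _
        _ ≤ m ^ (3 * 1 + 3) + (3 * 1 + 3) := imm_cost_le 1 m
        _ = m ^ 6 + 6 := by norm_num
  have hG' : IsVPFamily G' := (isVPFamily_renameEquiv_iff e G).2 hG
  have hG'N : IsVNPFamily G' := IsVPFamily.isVNPFamily_holds' hG'
  -- VNP-completeness of the permanent over ℂ: `G'` is a p-projection of `per`
  obtain ⟨t, ht, hproj⟩ := (isVNPComplete_perPoly_holds ℂ ringChar_complex_ne_two).2 v G' hG'N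
  obtain ⟨b, hb⟩ : IsPBounded fun m => t m ^ c + c :=
    IsPBounded.comp_holds (s := fun N => N ^ c + c) ⟨c, fun N => le_rfl⟩ ht
  obtain ⟨a, ha⟩ := ht
  -- circuits with few gates for `G m = IMM_{m, dd m}`, of product-depth `≤ ⌊p ⌊log₂log₂log₂ (t m)⌋ / q⌋`
  have key : ∀ m, ∃ D : ArithCircuit ℂ (Fin (dd m) × Fin m × Fin m),
      D.Computes (G m) ∧ D.productDepth ≤ p * Nat.log 2 (Nat.log 2 (Nat.log 2 (t m))) / q ∧
        D.size ≤ m ^ b + b := by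
    intro m
    obtain ⟨C, hCc, hCd, hCe⟩ := hc (t m)
    obtain ⟨D', hD'c, hD'd, hD'e, -⟩ := exists_circuit_of_isProjection (hproj m) C hCc
    have hGm : MvPolynomial.rename (e m).symm (G' m) = G m := by
      show MvPolynomial.rename (e m).symm (renameEquiv ℂ (e m) (G m)) = G m
      rw [renameEquiv_apply, rename_rename, (e m).symm_comp_self, rename_id_apply]
    obtain ⟨D, hDe, hDd, hDw, hDs⟩ := exists_size_le_edgeSize (D'.rename (e m).symm)
    refine ⟨D, ?_, ?_, ?_⟩
    · rw [Computes, hDe, ← hGm]; exact hD'c.rename (e m).symm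
    · exact hDd.trans ((DepthThreeChasm.productDepth_rename _ _).le.trans (hD'd.trans hCd))
    · calc D.size ≤ D.edgeSize := hDs
        _ ≤ (D'.rename (e m).symm).edgeSize := hDw
        _ = D'.edgeSize := DepthThreeChasm.edgeSize_rename _ _
        _ ≤ C.edgeSize := hD'e
        _ ≤ t m ^ c + c := hCe
        _ ≤ m ^ b + b := hb m
  -- the tower `m = 2^(2^(2^(qZ)))`, `Z = q + a + 2b + 64`, and the depth `Δ = pZ + 1`
  obtain ⟨Z, hZa, hZb⟩ : ∃ Z : ℕ, a + 1 ≤ 2 ^ (q * Z) ∧ q + 2 * b + 64 ≤ Z := by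
    refine ⟨q + a + 2 * b + 64, ?_, by omega⟩
    have h1 : q * (q + a + 2 * b + 64) < 2 ^ (q * (q + a + 2 * b + 64)) := Nat.lt_two_pow_self
    have h2 : q + a + 2 * b + 64 ≤ q * (q + a + 2 * b + 64) := Nat.le_mul_of_pos_left _ hq0
    omega
  obtain ⟨Δ, hΔ⟩ : ∃ Δ : ℕ, Δ = p * Z + 1 := ⟨_, rfl⟩
  have hΔ1 : 1 ≤ Δ := by omega
  have hdiv : p * (q * Z + 1) / q = p * Z := by
    rw [show p * (q * Z + 1) = p + q * (p * Z) by ring, Nat.add_mul_div_left _ _ hq0,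
      Nat.div_eq_of_lt hpq', zero_add]
  obtain ⟨m, W, hm2, hW1, hWm, hL3m, hlog3t, hWε, hthr, hfin⟩ :=
    tower_facts_gen (q * Z) b Δ hΔ1 (half_tower_arith p q Z b Δ (by omega) hZb hΔ)
  have hDp : Dp m = Δ := by
    show p * (Nat.log 2 (Nat.log 2 (Nat.log 2 m)) + 1) / q + 1 = Δ
    rw [hL3m, hdiv, hΔ]
  have hεm : ee m = mu Δ / (30000 * (Δ : ℝ)) := by
    show mu (Dp m) / (30000 * (Dp m : ℝ)) = _; rw [hDp]
  have hWdd : W ≤ dd m := by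
    refine le_min hWm (Nat.le_floor ?_)
    rw [hεm]; exact hWε
  have hdd1 : 1 ≤ dd m := hW1.trans hWdd
  obtain ⟨hdμ, hexp⟩ := hthr (dd m) hWdd
  have hdn : (dd m : ℝ) ≤ mu Δ / (30000 * (Δ : ℝ)) * Real.log m := hεm ▸ hdd_log m
  -- the transported circuit at `m` has product-depth `≤ pZ ≤ Δ`
  obtain ⟨D, hDc, hDd, hDs⟩ := key m
  have hY : Nat.log 2 (Nat.log 2 (Nat.log 2 (t m))) ≤ q * Z + 1 := hlog3t a (t m) hZa (ha m)
  have hDΔ : D.productDepth ≤ Δ := by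
    refine hDd.trans ?_
    calc p * Nat.log 2 (Nat.log 2 (Nat.log 2 (t m))) / q ≤ p * (q * Z + 1) / q :=
          Nat.div_le_div_right (Nat.mul_le_mul_left p hY)
      _ = p * Z := hdiv
      _ ≤ Δ := by omega
  -- LST with explicit constants at depth `Δ`, and the contradiction `m^{b+1} ≤ size ≤ m^b + b`
  have hlow : (m : ℝ) ^ ((dd m : ℝ) ^ (mu Δ / 2)) ≤ (D.size : ℝ) :=
    lst_explicit ℂ hΔ1 m (dd m) hdd1 hdμ hdn D hDΔ hDc
  have hmR1 : (1 : ℝ) ≤ m := by exact_mod_cast (show 1 ≤ m by omega)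
  exact hfin D.size hDs ((Real.rpow_le_rpow_of_exponent_le hmR1 hexp).trans hlow)

/-- **Registered-stub form** (crux `PerHardLog3`; every slope `p/q < 1/2` below it): for every exponent `c`
some `per_n` has NO circuit of product-depth `≤ ⌊p ⌊log₂⌊log₂⌊log₂ n⌋⌋⌋ / q⌋` with `≤ n ^ c + c` wires.
[cite: LimayeSrinivasanTavenas2025, Cor. 4] -/
theorem perHardBelowHalf_lst : ∀ p q c : ℕ, 2 * p < q → ∃ n : ℕ, ∀ C : ArithCircuit ℂ (Fin n × Fin n), C.Computes (perPoly (Fin n) ℂ) → C.productDepth ≤ p * Nat.log 2 (Nat.log 2 (Nat.log 2 n)) / q → n ^ c + c < C.edgeSize := by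
  intro p q c hpq
  by_contra h
  refine perHardBelowHalf p q hpq ⟨c, fun n => ?_⟩
  by_contra hn
  exact h ⟨n, fun C hC hd => not_le.mp fun hle => hn ⟨C, hC, hd, hle⟩⟩

end

end Summit.ValiantsHypothesis.ValiantsHypothesis.Theorems.DepthWindow
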